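import Literature.AlgebraicGeometry.Resolution.HenselizedRationalImmediateExtProofs
import Literature.AlgebraicGeometry.Resolution.HenselsLemmaProofs
import Literature.AlgebraicGeometry.Resolution.NormalDegreePDefectlessVTInseparable
import Literature.AlgebraicGeometry.Resolution.NormalDegreePDefectlessVTGalois
import Literature.AlgebraicGeometry.Resolution.RankOneDensity
import Literature.FieldTheory.ArtinSchreier.CyclicDegreeP
import Literature.FieldTheory.ArtinSchreier.PrimeDegree
import Mathlib.NumberTheory.Padics.PadicVal.Basic
import Mathlib.Algebra.Algebra.Operations
import Mathlib.LinearAlgebra.Finsupp.Span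
import HarnessLib

/-!
# `K[x,x⁻¹]` is dense in `K(x)^h` (Lemma 4.4) and the Artin–Schreier case Prop. 4.5 (Kuhlmann 2010, §2.1, §4.1)

Topic: `Literature/AlgebraicGeometry/Resolution` (valued function fields). Third layer below
`Kuhlmann2010GaloisDegreePDefectlessVT` (`NormalDegreePDefectlessVT.lean`,
`NormalDegreePDefectlessVTGalois.lean`): it PROVES the named fact `Kuhlmann2010Prop45ValueIndex`
= F.-V. Kuhlmann, *Elimination of ramification I: The generalized stability theorem*, Trans.
AMS 362 (2010) 5697–5727 = arXiv:1003.5678, **Prop. 4.5** (the equal-characteristic,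
value-transcendental case of Prop. 4.1, over an algebraically closed `K`), along the printed
route from **Lemma 2.4** ("If `(K,v)` is a valued field of rank `1`, then `K` is dense in its
henselization" — PROVED in `RankOneDensity.lean`, `exists_mem_valuation_sub_lt_of_isRankOneValued`):

> **Lemma 4.4.** Let `F = K(x)^h` where `(K(x),v)` is of rank 1 and `x` is value-transcendental
> over `K`. Then `R` is dense in `F`. If `char K = p`, then this implies that `F = R + ℘(F)`.
> *Proof.* Since `(K(x),v)` is of rank 1, we know from Lemma 2.4 that it is dense in `K(x)^h`.
> Now it suffices to prove that `R` is dense in its quotient field `K(x)`. … [geometric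
> expansion of `1/φ(x)`, `vK` archimedean] … We have now proved that `R` is dense in `F`. This
> means that `F = R + 𝓜_F`. If `char K = p`, then by (4.6) [`𝓜_F ⊂ ℘(F)`, Hensel's Lemma] it
> follows that `F = R + ℘(F)`.
>
> **Proposition 4.5.** … *Proof.* We can assume that `E|F` is of the form (4.4)
> [Artin–Schreier]. By Lemma 4.4 and (4.5), we can also assume that `a` is a finite Laurent
> series … we can replace a summand `c_{jp}x^{jp}` of `φ(x)` by a summand `c'_jx^j` with
> `c'_j = c_{jp}^{1/p} ∈ K` … there is `j ∈ I` such that `v(c₀ + ∑ cᵢxⁱ) = vc_jx^j < 0`.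
> Therefore, we must have that `vϑ < 0`. It follows that `vϑ^p = pvϑ < vϑ` and consequently,
> `pvϑ = vϑ^p = vc_jx^j` … As `j ∉ pℤ`, this value is not in `pvF`. Hence `(vE:vF) ≥ p`.

With it the italicized statement of §5 for `K(x)^h` (`Kuhlmann2010HenselizedRationalImmediateExt`)
rests on Prop. 4.6 (the mixed-characteristic Kummer case, `Kuhlmann2010Prop46ValueIndex`) alone
(`Kuhlmann2010HenselizedRationalImmediateExt.of_prop46`).

## Content

* The ring `R = K[x,x⁻¹]` as the `K`-span of the powers `xⁱ`, `i ∈ ℤ`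
  (`Submodule.span K (Set.range fun i : ℤ => x ^ i)`; its elements are the finite Laurent series
  `∑ cᵢxⁱ`, `c : ℤ →₀ K`, (4.10)): `finsupp_sum_mem_span`, `exists_finsupp_of_mem_span`,
  `mul_mem_span`, `aeval_mem_span`, `laurentSpan_le_adjoin`, and (4.11)
  `exists_valuation_finsupp_sum_eq` (the value of a finite Laurent series is that of its leading
  monomial, `x` value-transcendental). PROVED.
* `exists_mem_span_valuation_inv_sub_lt`, `exists_mem_span_valuation_sub_lt_of_mem_adjoin` — `R`
  is dense in `K(x)` (geometric expansion; archimedean values); `exists_mem_span_valuation_sub_lt`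
  — **Lemma 4.4**, `R` dense in `K(x)^h` (from Lemma 2.4 and Lemma 2.2);
  `exists_artinSchreierRoot_of_valuation_lt_one` — `𝓜_F ⊆ ℘(F)` ((4.6), Hensel's Lemma);
  `exists_mem_span_add_pow_sub_self_eq` — `F = R + ℘(F)`. PROVED.
* `exists_reduced_monomial`, `exists_normalForm_pow_sub_self` — the normal form of Prop. 4.5
  over an algebraically closed `K`: every `a ∈ F` is `∑_{i∈I} cᵢxⁱ + ℘(d)` with `I ⊂ ℤ ∖ pℤ` and
  all `vcᵢxⁱ < 0`. PROVED.
* `relIndex_valueSubgroup_eq_of_isGaloisStep_charP` — **Prop. 4.5**: `(vE:vF) = p` for a Galois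
  extension of degree `p` of `K(x)^h` in characteristic `p`. PROVED (Artin–Schreier theory from
  `Literature/FieldTheory/ArtinSchreier/`).
* `Kuhlmann2010Prop45ValueIndex_holds` — the DISCHARGE;
  `Kuhlmann2010HenselizedRationalImmediateExt.of_prop46` — the remaining trust base.

## Sources

* F.-V. Kuhlmann, *Elimination of ramification I: The generalized stability theorem*, Trans.
  Amer. Math. Soc. 362 (2010) 5697–5727 = arXiv:1003.5678: §2.1 (rank one; Lemma 2.4),
  Lemma 2.2, Lemma 2.5, §4 ((4.4)–(4.6)), §4.1 ((4.10)–(4.11), Lemma 4.4, Prop. 4.5).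
* E. Artin, O. Schreier (1927) / S. Lang, *Algebra*, VI §6 Thm. 6.4 — PROVED in
  `Literature/FieldTheory/ArtinSchreier/CyclicDegreeP.lean`.

## Rendering notes

* "Dense" is rendered pointwise in the valuation topology: `v(a − c) > v(b)` for every non-zero
  `b` of the SMALLER field (same value group: `K(x)^h|K(x)` is immediate, Lemma 2.2).
* The printed normal form keeps `c₀` and the condition `vc₀ > vcᵢxⁱ`; over an algebraically
  closed `K` the constant term lies in `℘(K)` and is absorbed, which is all Cor. 4.2 needs.
* What is NOT here: Prop. 4.6 (`char K = 0`: Kummer generators, Lemmas 2.9–2.10, Cor. 2.11 and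
  the elimination of `p`-th powers), which stays the named fact `Kuhlmann2010Prop46ValueIndex`.
-/

noncomputable section

open IsLocalRing Polynomial

namespace Literature.AlgebraicGeometry.Resolution

universe u

variable {Ω : Type u} [Field Ω] (V : ValuationSubring Ω)

/-! ### The ring `R = K[x, x⁻¹]` of finite Laurent series -/

section Laurent

variable {V} {K : Subfield Ω} {x : Ω}

/-- Values of monomials `c xⁱ`, `c ∈ K^×`, `i ∈ ℤ`, determine the exponent when `x` is
value-transcendental over `K`. [folklore] -/
theorem IsValueTranscendentalOver.eq_of_valuation_mul_zpow_eq (hx : IsValueTranscendentalOver V K x)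
    {c d : Ω} (hc : c ∈ K) (hd : d ∈ K) (hc0 : c ≠ 0) {i j : ℤ}
    (h : V.valuation (c * x ^ i) = V.valuation (d * x ^ j)) : i = j := by
  by_contra hij
  have hx0 : V.valuation x ≠ 0 := (_root_.map_ne_zero _).mpr hx.ne_zero
  have hvc : V.valuation c ≠ 0 := (_root_.map_ne_zero _).mpr hc0
  rw [map_mul, map_mul, map_zpow₀, map_zpow₀] at h
  have key : V.valuation x ^ (i - j) = V.valuation (d / c) := by
    rw [zpow_sub₀ hx0, map_div₀, div_eq_div_iff (zpow_ne_zero _ hx0) hvc]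
    calc V.valuation x ^ i * V.valuation c = V.valuation c * V.valuation x ^ i := mul_comm _ _
      _ = V.valuation d * V.valuation x ^ j := h
  exact hx.zpow_ne (sub_ne_zero.mpr hij) (div_mem hd hc) key

variable (K x)

/-- `K ⊆ R`. [folklore] -/
theorem mem_span_of_mem_subfield {a : Ω} (ha : a ∈ K) : a ∈ Submodule.span K (Set.range fun i : ℤ => x ^ i) := by
  have : a = (⟨a, ha⟩ : K) • x ^ (0 : ℤ) := by rw [zpow_zero, Algebra.smul_def, mul_one]; rfl
  rw [this]
  exact Submodule.smul_mem _ _ (Submodule.subset_span ⟨0, rfl⟩)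

/-- `c xⁱ ∈ R` for `c ∈ K`. [folklore] -/
theorem mul_zpow_mem_span {a : Ω} (ha : a ∈ K) (i : ℤ) :
    a * x ^ i ∈ Submodule.span K (Set.range fun i : ℤ => x ^ i) := by
  have : a * x ^ i = (⟨a, ha⟩ : K) • x ^ i := by rw [Algebra.smul_def]; rfl
  rw [this]
  exact Submodule.smul_mem _ _ (Submodule.subset_span ⟨i, rfl⟩)

/-- A finite Laurent series `∑ cᵢ xⁱ` (`c : ℤ →₀ K`) lies in the `K`-span `R = K[x,x⁻¹]` of the
powers `xⁱ`, `i ∈ ℤ`. [folklore] -/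
theorem finsupp_sum_mem_span (c : ℤ →₀ K) :
    (c.sum fun i a => (a : Ω) * x ^ i) ∈ Submodule.span K (Set.range fun i : ℤ => x ^ i) := by
  rw [Finsupp.sum]
  exact Submodule.sum_mem _ fun i _ => mul_zpow_mem_span K x (c i).2 i

/-- Every element of `R = K[x,x⁻¹]` is a finite Laurent series `∑ cᵢ xⁱ` with `c : ℤ →₀ K`
(Kuhlmann 2010, (4.10)). [cite: Kuhlmann2010, Section 4.1, (4.10)] -/
theorem exists_finsupp_of_mem_span {a : Ω} (ha : a ∈ Submodule.span K (Set.range fun i : ℤ => x ^ i)) :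
    ∃ c : ℤ →₀ K, a = c.sum fun i a => (a : Ω) * x ^ i := by
  obtain ⟨c, hc⟩ := (Finsupp.mem_span_range_iff_exists_finsupp).mp ha
  refine ⟨c, ?_⟩
  rw [← hc]
  apply Finsupp.sum_congr
  intro i _
  rw [Algebra.smul_def]
  rfl

/-- `R` is closed under multiplication (`xⁱ xʲ = xⁱ⁺ʲ`). [folklore] -/
theorem mul_mem_span (hx0 : x ≠ 0) {a b : Ω} (ha : a ∈ Submodule.span K (Set.range fun i : ℤ => x ^ i))
    (hb : b ∈ Submodule.span K (Set.range fun i : ℤ => x ^ i)) :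
    a * b ∈ Submodule.span K (Set.range fun i : ℤ => x ^ i) := by
  have h := Submodule.mul_mem_mul ha hb
  rw [Submodule.span_mul_span] at h
  refine Submodule.span_mono ?_ h
  rintro _ ⟨u, ⟨i, rfl⟩, w, ⟨j, rfl⟩, rfl⟩
  exact ⟨i + j, by simp [zpow_add₀ hx0]⟩

/-- Polynomials in `x` over `K` lie in `R`. [folklore] -/
theorem aeval_mem_span (r : K[X]) : aeval x r ∈ Submodule.span K (Set.range fun i : ℤ => x ^ i) := by
  rw [aeval_eq_sum_range]
  refine Submodule.sum_mem _ fun i _ => ?_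
  rw [← zpow_natCast]
  exact Submodule.smul_mem _ _ (Submodule.subset_span ⟨(i : ℤ), rfl⟩)

/-- `R ⊆ K(x)`. [folklore] -/
theorem laurentSpan_le_adjoin : ∀ a ∈ Submodule.span K (Set.range fun i : ℤ => x ^ i),
    a ∈ (IntermediateField.adjoin K ({x} : Set Ω)).toSubfield := by
  intro a ha
  induction ha using Submodule.span_induction with
  | mem y hy =>
    obtain ⟨i, rfl⟩ := hy
    exact zpow_mem (IntermediateField.subset_adjoin K ({x} : Set Ω) (Set.mem_singleton x)) i
  | zero => exact Subfield.zero_mem _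
  | add y z _ _ hy hz => exact add_mem hy hz
  | smul c y _ hy =>
    rw [Algebra.smul_def]
    exact mul_mem ((IntermediateField.adjoin K ({x} : Set Ω)).algebraMap_mem c) hy

variable {K x}

/-- **The value of a finite Laurent series is the value of its leading monomial** (Kuhlmann 2010,
(4.11): "`vφ(x) = min_{i∈I} vcᵢxⁱ = vc_kx^k` for a unique `k ∈ I` since `x` is
value-transcendental over `K`"): for `c : ℤ →₀ K` non-zero there is `k` in the support with
`v(∑ cᵢxⁱ) = v(c_k x^k)` and `v(cᵢxⁱ) < v(c_k x^k)` for the other `i` in the support. PROVED.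
[cite: Kuhlmann2010, Section 4.1, (4.11)] -/
theorem exists_valuation_finsupp_sum_eq (hx : IsValueTranscendentalOver V K x) {c : ℤ →₀ K}
    (hc : c ≠ 0) :
    ∃ k ∈ c.support, V.valuation (c.sum fun i a => (a : Ω) * x ^ i) = V.valuation ((c k : Ω) * x ^ k) ∧
      ∀ i ∈ c.support, i ≠ k → V.valuation ((c i : Ω) * x ^ i) < V.valuation ((c k : Ω) * x ^ k) := by
  classical
  have hne : c.support.Nonempty := Finsupp.support_nonempty_iff.mpr hc
  have hcoe : ∀ i ∈ c.support, ((c i : K) : Ω) ≠ 0 := fun i hi h0 =>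
    (Finsupp.mem_support_iff.mp hi) (Subtype.ext h0)
  have hinj : Set.InjOn (fun i => V.valuation ((c i : Ω) * x ^ i)) c.support := fun i hi j hj h =>
    hx.eq_of_valuation_mul_zpow_eq (c i).2 (c j).2 (hcoe i hi) h
  obtain ⟨k, hk, hsum, hmax⟩ := exists_valuation_sum_eq V c.support hne
    (fun i => ((c i : K) : Ω) * x ^ i) hinj
  refine ⟨k, hk, ?_, fun i hi hik => lt_of_le_of_ne (hmax i hi) fun h => hik (hinj hi hk h)⟩
  rw [Finsupp.sum]
  exact hsum

/-- A non-zero finite Laurent series has a non-zero value (its leading monomial is non-zero).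
[folklore] -/
theorem finsupp_sum_ne_zero (hx : IsValueTranscendentalOver V K x) {c : ℤ →₀ K} (hc : c ≠ 0) :
    (c.sum fun i a => (a : Ω) * x ^ i) ≠ 0 := by
  obtain ⟨k, hk, hsum, -⟩ := exists_valuation_finsupp_sum_eq hx hc
  intro h0
  rw [h0, map_zero, eq_comm, map_eq_zero] at hsum
  have hck : ((c k : K) : Ω) ≠ 0 := fun h => (Finsupp.mem_support_iff.mp hk) (Subtype.ext h)
  exact mul_ne_zero hck (zpow_ne_zero _ hx.ne_zero) hsum

end Laurent

/-! ### Lemma 4.4: `R = K[x,x⁻¹]` is dense in `F = K(x)^h` -/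

section Density

variable {V} {K : Subfield Ω} {x : Ω}

/-- **`R` is dense in `K(x)`: inverses** (Kuhlmann 2010, proof of Lemma 4.4: "it is enough to show
that for every `0 ≠ φ(x) ∈ R` and `α ∈ vK(x)` there is some `φ̃(x) ∈ R` such that
`v(1/φ(x) − φ̃(x)) > α` … We write `1/φ(x) = c_k⁻¹x⁻ᵏ/(1 − ψ(x))` with
`ψ(x) = 1 − c_k⁻¹x⁻ᵏφ(x) ∈ R`. Since `vψ(x) > 0` and `vK` is archimedean by hypothesis, there is
some `n ∈ ℕ` such that `(n+1)vψ(x) > α + vc_kx^k`. Then by the geometric expansion, the element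
`φ̃(x) := c_k⁻¹x⁻ᵏ ∑_{i=0}^n ψ(x)ⁱ ∈ R` satisfies `v(1/φ(x) − φ̃(x)) = (n+1)vψ(x) − vc_kx^k > α`").
Inside `(Ω, V)`: `x` value-transcendental over `K`, the values of a subfield `F' ⊇ K(x)`
archimedean (`IsRankOneValued V F'`), `φ ∈ R` non-zero, `b ∈ F'` non-zero; then
`v(φ⁻¹ − φ̃) < v(b)` for some `φ̃ ∈ R`. PROVED. [cite: Kuhlmann2010, Lemma 4.4 (proof)] -/
theorem exists_mem_span_valuation_inv_sub_lt (hx : IsValueTranscendentalOver V K x) {F' : Subfield Ω}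
    (hF' : IsRankOneValued V F') (hxF' : (IntermediateField.adjoin K ({x} : Set Ω)).toSubfield ≤ F')
    {φ : Ω} (hφ : φ ∈ Submodule.span K (Set.range fun i : ℤ => x ^ i)) (hφ0 : φ ≠ 0)
    {b : Ω} (hb : b ∈ F') (hb0 : b ≠ 0) :
    ∃ φ' ∈ Submodule.span K (Set.range fun i : ℤ => x ^ i), V.valuation (φ⁻¹ - φ') < V.valuation b := by
  classical
  obtain ⟨c, rfl⟩ := exists_finsupp_of_mem_span K x hφ
  have hc : c ≠ 0 := by
    rintro rfl
    exact hφ0 (by simp)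
  obtain ⟨k, hk, hval, hlt⟩ := exists_valuation_finsupp_sum_eq hx hc
  set φ := c.sum fun i a => (a : Ω) * x ^ i with hφdef
  set m : Ω := (c k : Ω) * x ^ k with hmdef
  have hckK : ((c k : K) : Ω) ∈ K := (c k).2
  have hck0 : ((c k : K) : Ω) ≠ 0 := fun h => (Finsupp.mem_support_iff.mp hk) (Subtype.ext h)
  have hm0 : m ≠ 0 := mul_ne_zero hck0 (zpow_ne_zero _ hx.ne_zero)
  have hvm : V.valuation m ≠ 0 := (_root_.map_ne_zero _).mpr hm0
  have hvφ : V.valuation φ = V.valuation m := hval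
  have hvφ0 : V.valuation φ ≠ 0 := by rw [hvφ]; exact hvm
  -- the ring `R`, its membership facts
  set R := Submodule.span K (Set.range fun i : ℤ => x ^ i) with hRdef
  have hmR : m⁻¹ ∈ R := by
    rw [hmdef, mul_inv, ← zpow_neg]
    exact mul_zpow_mem_span K x (K.inv_mem hckK) _
  have hφR : φ ∈ R := finsupp_sum_mem_span K x c
  -- `ψ = 1 − m⁻¹ φ` has value `< 1`
  set ψ : Ω := 1 - m⁻¹ * φ with hψdef
  have hψR : ψ ∈ R :=
    Submodule.sub_mem _ (mem_span_of_mem_subfield K x K.one_mem) (mul_mem_span K x hx.ne_zero hmR hφR)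
  have hψ : V.valuation ψ < 1 := by
    -- `m − φ = −∑_{i ≠ k} cᵢxⁱ` has value `< v(m)`
    have hsum : φ = m + (c.support.erase k).sum (fun i => ((c i : K) : Ω) * x ^ i) := by
      rw [hφdef, Finsupp.sum, ← Finset.add_sum_erase _ _ hk]
    have hrest : V.valuation ((c.support.erase k).sum fun i => ((c i : K) : Ω) * x ^ i) < V.valuation m := by
      refine Valuation.map_sum_lt _ hvm fun i hi => ?_
      obtain ⟨hik, hi'⟩ := Finset.mem_erase.mp hi
      exact hlt i hi' hik
    have h1 : ψ = -(m⁻¹ * (c.support.erase k).sum fun i => ((c i : K) : Ω) * x ^ i) := by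
      rw [hψdef, hsum, mul_add, inv_mul_cancel₀ hm0]
      ring
    rw [h1, Valuation.map_neg, map_mul, map_inv₀]
    calc (V.valuation m)⁻¹ * V.valuation ((c.support.erase k).sum fun i => ((c i : K) : Ω) * x ^ i)
        < (V.valuation m)⁻¹ * V.valuation m := mul_lt_mul_of_pos_left hrest (zero_lt_iff.mpr (inv_ne_zero hvm))
      _ = 1 := inv_mul_cancel₀ hvm
  have h1ψ : V.valuation (1 - ψ) = 1 := by
    rw [Valuation.map_sub_eq_of_lt_left V.valuation (x := (1 : Ω)) (y := ψ)
      (by rw [Valuation.map_one]; exact hψ), Valuation.map_one]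
  have h1ψ0 : 1 - ψ ≠ 0 := fun h0 => by
    rw [h0, map_zero] at h1ψ
    exact zero_ne_one h1ψ
  have hinv : φ⁻¹ = m⁻¹ * (1 - ψ)⁻¹ := by
    have : 1 - ψ = m⁻¹ * φ := by rw [hψdef]; ring
    rw [this]
    field_simp
  -- the partial geometric sums
  have hgeom : ∀ n : ℕ, φ⁻¹ - m⁻¹ * (Finset.range n).sum (fun i => ψ ^ i) = m⁻¹ * ψ ^ n * (1 - ψ)⁻¹ := by
    intro n
    rw [hinv]
    have hg := geom_sum_mul_neg ψ n
    field_simp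
    linear_combination -hg
  have hψpow : ∀ i : ℕ, ψ ^ i ∈ R := by
    intro i
    induction i with
    | zero => rw [pow_zero]; exact mem_span_of_mem_subfield K x K.one_mem
    | succ i ih => rw [pow_succ]; exact mul_mem_span K x hx.ne_zero ih hψR
  have hRn : ∀ n : ℕ, m⁻¹ * (Finset.range n).sum (fun i => ψ ^ i) ∈ R := fun n =>
    mul_mem_span K x hx.ne_zero hmR (Submodule.sum_mem _ fun i _ => hψpow i)
  -- the case `ψ = 0`: `φ⁻¹ = m⁻¹ ∈ R`
  by_cases hψ0 : ψ = 0
  · refine ⟨m⁻¹ * (Finset.range 1).sum (fun i => ψ ^ i), hRn 1, ?_⟩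
    rw [hgeom 1, hψ0, pow_one, mul_zero, zero_mul, map_zero]
    exact (Valuation.pos_iff _).mpr hb0
  -- archimedean: `v(ψ)^(n+1) < v(b) v(m)` for some `n`
  have hvψ0 : V.valuation ψ ≠ 0 := (_root_.map_ne_zero _).mpr hψ0
  have hψF' : ψ ∈ F' := hxF' (laurentSpan_le_adjoin K x ψ hψR)
  have hmF' : m ∈ F' := hxF' (laurentSpan_le_adjoin K x m (mul_zpow_mem_span K x hckK k))
  have hψinv : 1 < V.valuation ψ⁻¹ := by
    rw [map_inv₀]
    exact one_lt_inv_iff₀.mpr ⟨(Valuation.pos_iff _).mpr hψ0, hψ⟩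
  obtain ⟨n, hn⟩ := hF'.2 ψ⁻¹ (F'.inv_mem hψF') (b * m)⁻¹ (F'.inv_mem (F'.mul_mem hb hmF')) hψinv
  refine ⟨m⁻¹ * (Finset.range (n + 1)).sum (fun i => ψ ^ i), hRn (n + 1), ?_⟩
  rw [hgeom (n + 1), map_mul, map_mul, map_inv₀, map_inv₀, h1ψ, inv_one, mul_one, map_pow]
  have hpos1 : 0 < V.valuation b * V.valuation m :=
    mul_pos ((Valuation.pos_iff _).mpr hb0) ((Valuation.pos_iff _).mpr hm0)
  have hpos2 : 0 < V.valuation ψ ^ n := pow_pos ((Valuation.pos_iff _).mpr hψ0) n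
  have hn' : V.valuation ψ ^ n ≤ V.valuation b * V.valuation m := by
    rw [map_inv₀, map_mul, map_inv₀, inv_pow] at hn
    exact (inv_le_inv₀ hpos1 hpos2).mp hn
  have h3 : V.valuation ψ ^ (n + 1) < V.valuation b * V.valuation m := by
    rw [pow_succ]
    calc V.valuation ψ ^ n * V.valuation ψ < V.valuation ψ ^ n * 1 := mul_lt_mul_of_pos_left hψ hpos2
      _ = V.valuation ψ ^ n := mul_one _
      _ ≤ V.valuation b * V.valuation m := hn'
  calc (V.valuation m)⁻¹ * V.valuation ψ ^ (n + 1)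
      < (V.valuation m)⁻¹ * (V.valuation b * V.valuation m) :=
        mul_lt_mul_of_pos_left h3 (zero_lt_iff.mpr (inv_ne_zero hvm))
    _ = V.valuation b := by
        rw [mul_comm (V.valuation b), ← mul_assoc, inv_mul_cancel₀ hvm, one_mul]

/-- **`R` is dense in `K(x)`** (Kuhlmann 2010, proof of Lemma 4.4: "Now it suffices to prove
that `R` is dense in its quotient field `K(x)`"): every `a ∈ K(x)` is `ρ/σ` with polynomials
`ρ, σ ∈ K[x] ⊆ R`, and `ρ·σ̃` with `σ̃ ∈ R` close to `σ⁻¹` is close to `a`. PROVED.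
[cite: Kuhlmann2010, Lemma 4.4 (proof)] -/
theorem exists_mem_span_valuation_sub_lt_of_mem_adjoin (hx : IsValueTranscendentalOver V K x)
    {F' : Subfield Ω} (hF' : IsRankOneValued V F')
    (hxF' : (IntermediateField.adjoin K ({x} : Set Ω)).toSubfield ≤ F')
    {a : Ω} (ha : a ∈ (IntermediateField.adjoin K ({x} : Set Ω)).toSubfield)
    {b : Ω} (hb : b ∈ F') (hb0 : b ≠ 0) :
    ∃ r ∈ Submodule.span K (Set.range fun i : ℤ => x ^ i), V.valuation (a - r) < V.valuation b := by
  have hvb : 0 < V.valuation b := (Valuation.pos_iff _).mpr hb0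
  obtain ⟨r, s, hars⟩ := (IntermediateField.mem_adjoin_simple_iff (F := K) (α := x) a).mp ha
  by_cases hσ : aeval x s = 0
  · refine ⟨0, Submodule.zero_mem _, ?_⟩
    rw [hars, hσ, div_zero, sub_zero, map_zero]
    exact hvb
  by_cases hρ : aeval x r = 0
  · refine ⟨0, Submodule.zero_mem _, ?_⟩
    rw [hars, hρ, zero_div, sub_zero, map_zero]
    exact hvb
  have hρF' : aeval x r ∈ F' := hxF' (laurentSpan_le_adjoin K x _ (aeval_mem_span K x r))
  have hvρ : V.valuation (aeval x r) ≠ 0 := (_root_.map_ne_zero _).mpr hρ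
  obtain ⟨φ', hφ', hlt⟩ := exists_mem_span_valuation_inv_sub_lt hx hF' hxF' (aeval_mem_span K x s)
    hσ (F'.div_mem hb hρF') (div_ne_zero hb0 hρ)
  refine ⟨aeval x r * φ', mul_mem_span K x hx.ne_zero (aeval_mem_span K x r) hφ', ?_⟩
  have : a - aeval x r * φ' = aeval x r * ((aeval x s)⁻¹ - φ') := by
    rw [hars, div_eq_mul_inv]
    ring
  rw [this, map_mul]
  calc V.valuation (aeval x r) * V.valuation ((aeval x s)⁻¹ - φ')
      < V.valuation (aeval x r) * V.valuation (b / aeval x r) :=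
        mul_lt_mul_of_pos_left hlt (zero_lt_iff.mpr hvρ)
    _ = V.valuation b := by rw [map_div₀, mul_div_cancel₀ _ hvρ]

/-- **Kuhlmann 2010, Lemma 4.4: `R = K[x,x⁻¹]` is dense in `F = K(x)^h`.** "Let `F = K(x)^h`
where `(K(x),v)` is of rank 1 and `x` is value-transcendental over `K`. Then `R` is dense in `F`.
… *Proof.* Since `(K(x),v)` is of rank 1, we know from Lemma 2.4 that it is dense in `K(x)^h`.
Now it suffices to prove that `R` is dense in its quotient field `K(x)`." Inside the
algebraically closed `(Ω, V)`: `x` value-transcendental over `K`, `K(x)^h = henselizedAdjoin V K x`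
of rank one (`IsRankOneValued`); then for `a ∈ K(x)^h` and non-zero `b ∈ K(x)^h` there is `r ∈ R`
with `v(a − r) > v(b)`. PROVED from Lemma 2.4 (`exists_mem_valuation_sub_lt_of_isRankOneValued`, `RankOneDensity.lean`)
and Lemma 2.2 (`K(x)^h|K(x)` is immediate, `Kuhlmann2010HenselizationImmediate_holds`).
[cite: Kuhlmann2010, Lemma 4.4] -/
theorem exists_mem_span_valuation_sub_lt [IsAlgClosed Ω]
    (hx : IsValueTranscendentalOver V K x) (hr : IsRankOneValued V (henselizedAdjoin V K x))
    {a : Ω} (ha : a ∈ henselizedAdjoin V K x) {b : Ω} (hb : b ∈ henselizedAdjoin V K x) (hb0 : b ≠ 0) :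
    ∃ r ∈ Submodule.span K (Set.range fun i : ℤ => x ^ i), V.valuation (a - r) < V.valuation b := by
  set Kx : Subfield Ω := (IntermediateField.adjoin K ({x} : Set Ω)).toSubfield with hKxdef
  have hxKx : x ∈ Kx := IntermediateField.subset_adjoin K ({x} : Set Ω) (Set.mem_singleton x)
  have hrKx : IsRankOneValued V Kx :=
    hr.of_le_of_isValueTranscendentalOver (adjoin_le_henselizedAdjoin V K x) hx hxKx
  -- the threshold `v(b)` is the value of an element of `K(x)` (Lemma 2.2)
  obtain ⟨b', hb', hbb'⟩ := (Kuhlmann2010HenselizationImmediate_holds Ω V Kx).1 b hb hb0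
  have hb'0 : b' ≠ 0 := by
    rintro rfl
    rw [map_zero, map_eq_zero] at hbb'
    exact hb0 hbb'
  -- Lemma 2.4: `c ∈ K(x)` close to `a`; then `r ∈ R` close to `c`
  obtain ⟨c, hc, hac⟩ := exists_mem_valuation_sub_lt_of_isRankOneValued (V := V) hrKx ha hb' hb'0
  obtain ⟨r, hrR, hcr⟩ := exists_mem_span_valuation_sub_lt_of_mem_adjoin hx hrKx le_rfl hc hb' hb'0
  refine ⟨r, hrR, ?_⟩
  have : a - r = (a - c) + (c - r) := by ring
  rw [hbb', this]
  exact Valuation.map_add_lt _ hac hcr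

/-- **`F = R + 𝓜_F`** (Kuhlmann 2010, proof of Lemma 4.4: "We have now proved that `R` is
dense in `F`. This means that `F = R + 𝓜_F`"): every `a ∈ K(x)^h` is `r + m` with `r ∈ R` and
`v(m) > 0`. PROVED. [cite: Kuhlmann2010, Lemma 4.4 (proof)] -/
theorem exists_mem_span_valuation_sub_lt_one [IsAlgClosed Ω]
    (hx : IsValueTranscendentalOver V K x) (hr : IsRankOneValued V (henselizedAdjoin V K x))
    {a : Ω} (ha : a ∈ henselizedAdjoin V K x) :
    ∃ r ∈ Submodule.span K (Set.range fun i : ℤ => x ^ i), V.valuation (a - r) < 1 := by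
  have h := exists_mem_span_valuation_sub_lt hx hr ha (Subfield.one_mem _) one_ne_zero
  rwa [map_one] at h

end Density

/-! ### `𝓜_F ⊆ ℘(F)` and `F = R + ℘(F)` in characteristic `p` -/

section ArtinSchreierPart

variable {V}

/-- **`𝓜_F ⊆ ℘(F)` in a henselian field of characteristic `p`** (Kuhlmann 2010, (4.6): "Note
that by Hensel's Lemma, `X^p − X − a` has a root in the henselian field `F` whenever `va > 0`.
For the valuation ideal `𝓜_F` of `F`, we thus have `𝓜_F ⊂ ℘(F)`"): inside `(Ω, V)` of
characteristic `p`, if `V ∩ M` satisfies Hensel's Lemma and `m ∈ M` has `v(m) > 0`, then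
`m = d^p − d` for some `d ∈ M` with `v(d) > 0`. PROVED (Hensel's Lemma for `X^p − X − m` at
`0`, whose derivative there is `−1`). [cite: Kuhlmann2010, Section 4, (4.6)] -/
theorem exists_artinSchreierRoot_of_valuation_lt_one {p : ℕ} [Fact p.Prime] [CharP Ω p]
    {M : Subfield Ω} (hM : HenselianLocalRing (V.comap (algebraMap M Ω)))
    {m : Ω} (hmM : m ∈ M) (hm : V.valuation m < 1) :
    ∃ d ∈ M, d ^ p - d = m ∧ V.valuation d < 1 := by
  haveI := hM
  have hp : p.Prime := Fact.out
  set O := V.comap (algebraMap M Ω) with hO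
  haveI : CharP M p := (algebraMap M Ω).charP Subtype.val_injective p
  haveI : CharP O p := (algebraMap O M).charP Subtype.val_injective p
  have hmV : m ∈ V := (V.valuation_le_one_iff m).mp hm.le
  set mO : O := ⟨⟨m, hmM⟩, hmV⟩ with hmO
  set f : Polynomial O := X ^ p - X - C mO with hf
  have hmonic : f.Monic := by
    have hdeg : degree (X + C mO : Polynomial O) < (p : WithBot ℕ) := by
      rw [degree_X_add_C]
      exact_mod_cast hp.one_lt
    rw [hf, sub_sub]
    exact monic_X_pow_sub hdeg
  have h1 : f.eval 0 ∈ maximalIdeal O := by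
    rw [mem_maximalIdeal_comap_subfield_iff]
    have : f.eval 0 = -mO := by simp [hf, zero_pow hp.ne_zero]
    rw [this]
    change V.valuation (-m) < 1
    rw [Valuation.map_neg]
    exact hm
  have h2 : IsUnit (f.derivative.eval 0) := by
    have : f.derivative.eval 0 = -1 := by
      simp [hf, derivative_X_pow, CharP.cast_eq_zero]
    rw [this]
    exact isUnit_one.neg
  obtain ⟨a, ha, ha0⟩ := HenselianLocalRing.is_henselian f hmonic 0 h1 h2
  refine ⟨((a : M) : Ω), (a : M).2, ?_, ?_⟩
  · have h3 : a ^ p - a = mO := by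
      have := ha.eq_zero
      simp only [hf, eval_sub, eval_pow, eval_X, eval_C] at this
      exact sub_eq_zero.mp this
    have := congrArg (fun z : O => (((z : M) : Ω))) h3
    simpa using this
  · rw [sub_zero] at ha0
    exact (mem_maximalIdeal_comap_subfield_iff V M a).mp ha0

/-- **`F = R + ℘(F)`** (Kuhlmann 2010, Lemma 4.4: "If `char K = p`, then this implies that
`F = R + ℘(F)`"): for `F = K(x)^h` of rank one, `x` value-transcendental over `K`, inside the
algebraically closed `(Ω, V)` of characteristic `p`, every `a ∈ F` is `r + (d^p − d)` with
`r ∈ R = K[x,x⁻¹]` and `d ∈ F`. PROVED from Lemma 2.4 (`RankOneDensity.lean`) and Hensel's Lemma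
(`Kuhlmann2010HenselsLemma_holds`: `K(x)^h` is henselian).
[cite: Kuhlmann2010, Lemma 4.4] -/
theorem exists_mem_span_add_pow_sub_self_eq [IsAlgClosed Ω] {p : ℕ} [Fact p.Prime] [CharP Ω p]
    {K : Subfield Ω} {x : Ω}
    (hx : IsValueTranscendentalOver V K x) (hr : IsRankOneValued V (henselizedAdjoin V K x))
    {a : Ω} (ha : a ∈ henselizedAdjoin V K x) :
    ∃ r ∈ Submodule.span K (Set.range fun i : ℤ => x ^ i), ∃ d ∈ henselizedAdjoin V K x,
      a = r + (d ^ p - d) := by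
  obtain ⟨r, hrR, hlt⟩ := exists_mem_span_valuation_sub_lt_one hx hr ha
  have hF : IsHenselianField (henselizedAdjoin V K x) (V.comap (algebraMap (henselizedAdjoin V K x) Ω)) :=
    isHenselianField_henselizedAdjoin Kuhlmann2010HenselizationIsHenselian_holds K x
  have hH : HenselianLocalRing (V.comap (algebraMap (henselizedAdjoin V K x) Ω)) :=
    Kuhlmann2010HenselsLemma_holds _ _ hF
  have har : a - r ∈ henselizedAdjoin V K x :=
    sub_mem ha (adjoin_le_henselizedAdjoin V K x (laurentSpan_le_adjoin K x r hrR))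
  obtain ⟨d, hd, hdeq, -⟩ := exists_artinSchreierRoot_of_valuation_lt_one hH har hlt
  exact ⟨r, hrR, d, hd, by rw [hdeq]; ring⟩

end ArtinSchreierPart

/-! ### `℘(F)`: the image of the Artin–Schreier map as an additive subgroup -/

section PImage

variable {V}

/-- `℘(d₁) + ℘(d₂) = ℘(d₁ + d₂)` in characteristic `p`: sums of elements of
`℘(F) = {d^p − d : d ∈ F}` are in `℘(F)`. [cite: Kuhlmann2010, Section 4, (4.5)] -/
theorem exists_pow_sub_self_add {p : ℕ} [Fact p.Prime] [CharP Ω p] {F : Subfield Ω} {a b : Ω}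
    (ha : ∃ d ∈ F, a = d ^ p - d) (hb : ∃ d ∈ F, b = d ^ p - d) : ∃ d ∈ F, a + b = d ^ p - d := by
  obtain ⟨d₁, hd₁, rfl⟩ := ha
  obtain ⟨d₂, hd₂, rfl⟩ := hb
  exact ⟨d₁ + d₂, add_mem hd₁ hd₂, by rw [add_pow_char]; ring⟩

/-- `0 ∈ ℘(F)`. [folklore] -/
theorem exists_pow_sub_self_zero {p : ℕ} [Fact p.Prime] {F : Subfield Ω} :
    ∃ d ∈ F, (0 : Ω) = d ^ p - d :=
  ⟨0, F.zero_mem, by rw [zero_pow (Fact.out : p.Prime).ne_zero, sub_zero]⟩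

/-- Finite sums of elements of `℘(F)` are in `℘(F)`. [folklore] -/
theorem exists_pow_sub_self_sum {p : ℕ} [Fact p.Prime] [CharP Ω p] {F : Subfield Ω} {ι : Type*}
    (s : Finset ι) (f : ι → Ω) (h : ∀ i ∈ s, ∃ d ∈ F, f i = d ^ p - d) :
    ∃ d ∈ F, ∑ i ∈ s, f i = d ^ p - d := by
  classical
  induction s using Finset.induction_on with
  | empty => rw [Finset.sum_empty]; exact exists_pow_sub_self_zero
  | insert i s hi ih =>
    rw [Finset.sum_insert hi]
    exact exists_pow_sub_self_add (h i (Finset.mem_insert_self i s))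
      (ih fun j hj => h j (Finset.mem_insert_of_mem hj))

/-- `y^{p^ν} − y ∈ ℘(F)` for `y ∈ F` (telescoping `∑_{k<ν} ℘(y^{p^k})`). [folklore] -/
theorem exists_pow_sub_self_pow_pow_sub {p : ℕ} [Fact p.Prime] [CharP Ω p] {F : Subfield Ω}
    {y : Ω} (hy : y ∈ F) (ν : ℕ) : ∃ d ∈ F, y ^ p ^ ν - y = d ^ p - d := by
  induction ν with
  | zero => rw [pow_zero, pow_one, sub_self]; exact exists_pow_sub_self_zero
  | succ ν ih =>
    have : y ^ p ^ (ν + 1) - y = ((y ^ p ^ ν) ^ p - y ^ p ^ ν) + (y ^ p ^ ν - y) := by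
      rw [pow_succ, pow_mul]; ring
    rw [this]
    exact exists_pow_sub_self_add ⟨y ^ p ^ ν, pow_mem hy _, rfl⟩ ih

end PImage

/-! ### Prop. 4.5: the value index of an Artin–Schreier extension of `K(x)^h` -/

section Prop45

variable {V}

/-- **Reduction of a monomial** (Kuhlmann 2010, proof of Prop. 4.5: "we can replace a summand
`c_{jp}x^{jp}` of `φ(x)` by a summand `c'_jx^j` with `c'_j = c_{jp}^{1/p} ∈ K` (as `K` is assumed
to be perfect). After a finite repetition of this procedure …"): over an algebraically closed
`K ≤ F` (characteristic `p`), every monomial `c xⁱ`, `c ∈ K`, `x ∈ F`, is congruent modulo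
`℘(F)` to a monomial `c' xʲ` with `c' ∈ K` and `j = 0 ∨ p ∤ j` (indeed `i = j p^ν`,
`c = c'^{p^ν}`). PROVED. [cite: Kuhlmann2010, Prop. 4.5 (proof)] -/
theorem exists_reduced_monomial {p : ℕ} [Fact p.Prime] [CharP Ω p] {K F : Subfield Ω}
    (hK : IsAlgClosed K) (hKF : K ≤ F) {x : Ω} (hxF : x ∈ F) {c : Ω} (hc : c ∈ K)
    (i : ℤ) : ∃ c' ∈ K, ∃ j : ℤ, (j = 0 ∨ ¬ (p : ℤ) ∣ j) ∧ (c = 0 → c' = 0) ∧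
      ∃ d ∈ F, c * x ^ i = c' * x ^ j + (d ^ p - d) := by
  haveI := hK
  have hp : p.Prime := Fact.out
  -- write `i = j p^ν` with `p ∤ j` (or `i = 0`)
  obtain ⟨ν, j, hij, hj⟩ : ∃ (ν : ℕ) (j : ℤ), i = j * (p : ℤ) ^ ν ∧ (j = 0 ∨ ¬ (p : ℤ) ∣ j) := by
    rcases eq_or_ne i 0 with rfl | hi0
    · exact ⟨0, 0, by simp, Or.inl rfl⟩
    · set ν := padicValInt p i with hν
      have h2 : i / (p : ℤ) ^ ν * (p : ℤ) ^ ν = i :=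
        Int.ediv_mul_cancel ((padicValInt_dvd_iff _ _).mpr (Or.inr (le_of_eq hν)))
      refine ⟨ν, i / (p : ℤ) ^ ν, h2.symm, Or.inr fun hdvd => ?_⟩
      obtain ⟨k, hk⟩ := hdvd
      have h1 : (p : ℤ) ^ (ν + 1) ∣ i :=
        ⟨k, calc i = i / (p : ℤ) ^ ν * (p : ℤ) ^ ν := h2.symm
          _ = (p : ℤ) * k * (p : ℤ) ^ ν := by rw [hk]
          _ = (p : ℤ) ^ (ν + 1) * k := by ring⟩
      rcases (padicValInt_dvd_iff _ _).mp h1 with h0 | hle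
      · exact hi0 h0
      · omega
  -- `c = c'^{p^ν}` with `c' ∈ K`
  obtain ⟨c', hc'⟩ := IsAlgClosed.exists_pow_nat_eq (⟨c, hc⟩ : K) (pow_pos hp.pos ν)
  have hcc' : ((c' : K) : Ω) ^ p ^ ν = c := by
    have := congrArg (fun z : K => (z : Ω)) hc'
    simpa using this
  refine ⟨c', c'.2, j, hj, fun h0 => ?_, ?_⟩
  · have : ((c' : K) : Ω) ^ p ^ ν = 0 := by rw [hcc', h0]
    exact pow_eq_zero_iff (pow_ne_zero ν hp.ne_zero) |>.mp this
  · -- `c xⁱ = (c' xʲ)^{p^ν} ≡ c' xʲ`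
    have hy : ((c' : K) : Ω) * x ^ j ∈ F := mul_mem (hKF c'.2) (zpow_mem hxF j)
    obtain ⟨d, hd, hdeq⟩ := exists_pow_sub_self_pow_pow_sub hy ν
    refine ⟨d, hd, ?_⟩
    rw [← hdeq, hij, ← hcc', mul_pow, ← zpow_natCast (x ^ j), ← zpow_mul]
    push_cast
    ring

/-- **Kuhlmann 2010, Prop. 4.5, the normal form over an algebraically closed `K`**: for
`F = K(x)^h` of rank one (`x` value-transcendental over the algebraically closed `K ≤ Ω`,
`char Ω = p`), every `a ∈ F` is congruent modulo `℘(F)` to a finite Laurent series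
`r = ∑_{i∈I} cᵢxⁱ` with `I ⊂ ℤ ∖ pℤ` and all `vcᵢxⁱ < 0` (multiplicatively `> 1`) — the printed
normal form with `c₀` absorbed into `℘(K) ⊆ ℘(F)` and the summands of positive value absorbed
into `𝓜_F ⊆ ℘(F)`. PROVED from Lemma 4.4 (`exists_mem_span_add_pow_sub_self_eq`).
[cite: Kuhlmann2010, Prop. 4.5 (proof)] -/
theorem exists_normalForm_pow_sub_self [IsAlgClosed Ω] {p : ℕ} [Fact p.Prime] [CharP Ω p]
    {K : Subfield Ω} (hK : IsAlgClosed K) {x : Ω}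
    (hx : IsValueTranscendentalOver V K x) (hr : IsRankOneValued V (henselizedAdjoin V K x))
    {a : Ω} (ha : a ∈ henselizedAdjoin V K x) :
    ∃ c : ℤ →₀ K, (∀ i ∈ c.support, ¬ (p : ℤ) ∣ i ∧ 1 < V.valuation ((c i : Ω) * x ^ i)) ∧
      ∃ d ∈ henselizedAdjoin V K x, a = (c.sum fun i b => (b : Ω) * x ^ i) + (d ^ p - d) := by
  classical
  haveI := hK
  have hp : p.Prime := Fact.out
  have hKF : K ≤ henselizedAdjoin V K x := le_henselizedAdjoin V K x
  have hxF : x ∈ henselizedAdjoin V K x := mem_henselizedAdjoin_self V K x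
  have hFh : IsHenselianField (henselizedAdjoin V K x)
      (V.comap (algebraMap (henselizedAdjoin V K x) Ω)) :=
    isHenselianField_henselizedAdjoin Kuhlmann2010HenselizationIsHenselian_holds K x
  have hH : HenselianLocalRing (V.comap (algebraMap (henselizedAdjoin V K x) Ω)) :=
    Kuhlmann2010HenselsLemma_holds _ _ hFh
  ---------------------------------------------------------------- Lemma 4.4: `a = ∑ cᵢxⁱ + ℘(d₀)`
  obtain ⟨r₀, hr₀, d₀, hd₀, har₀⟩ := exists_mem_span_add_pow_sub_self_eq (p := p) hx hr ha
  obtain ⟨c₀, rfl⟩ := exists_finsupp_of_mem_span K x hr₀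
  ---------------------------------------------------------------- reduce every monomial
  choose! cf hcfK jf hjf hcf0 df hdfF hdf using
    fun i : ℤ => exists_reduced_monomial (p := p) (F := henselizedAdjoin V K x) hK hKF hxF (c₀ i).2 i
  -- the reduced Laurent series
  set c₁ : ℤ →₀ K := ∑ i ∈ c₀.support, Finsupp.single (jf i) ⟨cf i, hcfK i⟩ with hc₁def
  have hc₁sum : (c₁.sum fun i b => (b : Ω) * x ^ i) = ∑ i ∈ c₀.support, cf i * x ^ jf i := by
    rw [hc₁def, ← Finsupp.sum_finsetSum_index]
    · refine Finset.sum_congr rfl fun i _ => ?_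
      rw [Finsupp.sum_single_index]
      rw [Subfield.coe_zero]
      exact zero_mul _
    · intro i; exact zero_mul _
    · intro i b₁ b₂; rw [Subfield.coe_add]; exact add_mul _ _ _
  have hc₁supp : ∀ j ∈ c₁.support, j = 0 ∨ ¬ (p : ℤ) ∣ j := by
    intro j hj
    rw [hc₁def] at hj
    obtain ⟨i, -, hij⟩ := Finset.mem_biUnion.mp (Finsupp.support_finsetSum hj)
    have : j = jf i := by
      have := Finsupp.support_single_subset hij
      simpa using this
    rw [this]
    exact hjf i
  have hequiv₁ : ∃ d ∈ henselizedAdjoin V K x, (c₀.sum fun i b => (b : Ω) * x ^ i) =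
      (c₁.sum fun i b => (b : Ω) * x ^ i) + (d ^ p - d) := by
    rw [hc₁sum, Finsupp.sum]
    obtain ⟨d, hd, hdeq⟩ := exists_pow_sub_self_sum (p := p) (F := henselizedAdjoin V K x) c₀.support
      (fun i => ((c₀ i : K) : Ω) * x ^ i - cf i * x ^ jf i) fun i _ =>
        ⟨df i, hdfF i, by rw [hdf i]; ring⟩
    refine ⟨d, hd, ?_⟩
    rw [← hdeq, ← Finset.sum_add_distrib]
    exact Finset.sum_congr rfl fun i _ => by ring
  ---------------------------------------------------------------- keep the monomials of negative value
  set P : ℤ → Prop := fun j => j ≠ 0 ∧ 1 < V.valuation ((c₁ j : Ω) * x ^ j) with hPdef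
  set c : ℤ →₀ K := c₁.filter P with hcdef
  set c' : ℤ →₀ K := c₁.filter (fun j => ¬ P j) with hc'def
  have hcsupp : ∀ i ∈ c.support, ¬ (p : ℤ) ∣ i ∧ 1 < V.valuation ((c i : Ω) * x ^ i) := by
    intro i hi
    rw [hcdef, Finsupp.support_filter, Finset.mem_filter] at hi
    obtain ⟨hi₁, hi0, hiv⟩ := hi
    have hci : c i = c₁ i := by rw [hcdef, Finsupp.filter_apply_pos _ _ ⟨hi0, hiv⟩]
    refine ⟨fun hdvd => ?_, by rw [hci]; exact hiv⟩
    rcases hc₁supp i hi₁ with h0 | hnd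
    · exact hi0 h0
    · exact hnd hdvd
  have hsplit : (c₁.sum fun i b => (b : Ω) * x ^ i) =
      (c.sum fun i b => (b : Ω) * x ^ i) + (c'.sum fun i b => (b : Ω) * x ^ i) := by
    rw [hcdef, hc'def, ← Finsupp.sum_add_index', Finsupp.filter_add_filter_not]
    · intro i; exact zero_mul _
    · intro i b₁ b₂; rw [Subfield.coe_add]; exact add_mul _ _ _
  -- the discarded part lies in `K + 𝓜_F ⊆ ℘(F)`
  have hequiv₂ : ∃ d ∈ henselizedAdjoin V K x, (c'.sum fun i b => (b : Ω) * x ^ i) = d ^ p - d := by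
    rw [Finsupp.sum]
    refine exists_pow_sub_self_sum (p := p) (F := henselizedAdjoin V K x) c'.support _ fun i hi => ?_
    rw [hc'def, Finsupp.support_filter, Finset.mem_filter] at hi
    obtain ⟨hi₁, hneg⟩ := hi
    have hc'i : ((c' i : K) : Ω) = (c₁ i : Ω) := by
      rw [hc'def, Finsupp.filter_apply_pos (fun j => ¬ P j) c₁ hneg]
    rw [hc'i]
    have hci0 : ((c₁ i : K) : Ω) ≠ 0 := fun h0 => (Finsupp.mem_support_iff.mp hi₁) (Subtype.ext h0)
    by_cases hi0 : i = 0
    · -- the constant term: `K = ℘(K)` for `K` algebraically closed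
      subst hi0
      obtain ⟨κ, hκ⟩ : ∃ κ : K, κ ^ p - κ = c₁ 0 := by
        have hlt1 : (X : K[X]).degree < (X ^ p : K[X]).degree := by
          rw [degree_X_pow, degree_X]
          exact_mod_cast hp.one_lt
        have hdeg1 : (X ^ p - X : K[X]).degree = p := by
          rw [degree_sub_eq_left_of_degree_lt hlt1, degree_X_pow]
        have hlt2 : (C (c₁ 0) : K[X]).degree < (X ^ p - X : K[X]).degree := by
          rw [hdeg1]
          exact lt_of_le_of_lt degree_C_le (by exact_mod_cast hp.pos)
        have hdeg2 : (X ^ p - X - C (c₁ 0) : K[X]).degree = p := by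
          rw [degree_sub_eq_left_of_degree_lt hlt2, hdeg1]
        obtain ⟨κ, hκ⟩ := IsAlgClosed.exists_root (X ^ p - X - C (c₁ 0) : K[X])
          (by rw [hdeg2]; exact_mod_cast hp.ne_zero)
        refine ⟨κ, ?_⟩
        have := hκ
        simp only [Polynomial.IsRoot, Polynomial.eval_sub, Polynomial.eval_pow, Polynomial.eval_X,
          Polynomial.eval_C] at this
        exact sub_eq_zero.mp this
      refine ⟨κ, hKF κ.2, ?_⟩
      rw [zpow_zero, mul_one]
      have := congrArg (fun z : K => (z : Ω)) hκ
      simpa using this.symm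
    · -- a monomial of positive value: in `𝓜_F ⊆ ℘(F)`
      have hle : V.valuation ((c₁ i : Ω) * x ^ i) ≤ 1 := not_lt.mp fun hlt => hneg ⟨hi0, hlt⟩
      have hne : V.valuation ((c₁ i : Ω) * x ^ i) ≠ 1 := by
        intro h1
        rw [map_mul, map_zpow₀] at h1
        apply hx.zpow_ne hi0 (K.inv_mem (c₁ i).2)
        rw [map_inv₀]
        exact (inv_eq_of_mul_eq_one_right h1).symm
      obtain ⟨d, hd, hdeq, -⟩ := exists_artinSchreierRoot_of_valuation_lt_one (p := p) hH
        (mul_mem (hKF (c₁ i).2) (zpow_mem hxF i)) (lt_of_le_of_ne hle hne)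
      exact ⟨d, hd, hdeq.symm⟩
  ---------------------------------------------------------------- assemble
  obtain ⟨d₁, hd₁, heq₁⟩ := hequiv₁
  obtain ⟨d₂, hd₂, heq₂⟩ := hequiv₂
  refine ⟨c, hcsupp, d₀ + d₁ + d₂, add_mem (add_mem hd₀ hd₁) hd₂, ?_⟩
  rw [har₀, heq₁, hsplit, heq₂, add_pow_char, add_pow_char]
  ring

/-- **Kuhlmann 2010, Prop. 4.5 over an algebraically closed `K`: `(vE:vF) = p`** ("If (4.6)
does not hold, then `(vE:vF) = p` … *Proof.* … Since the elements `xⁱ`, `i ∈ ℤ`, are valuation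
independent over `K`, there is `j ∈ I` such that `v(c₀ + ∑ cᵢxⁱ) = vc_jx^j < 0`. Therefore, we
must have that `vϑ < 0`. It follows that `vϑ^p = pvϑ < vϑ` and consequently, `pvϑ = vϑ^p = vc_jx^j`
by the ultrametric triangle law. As `j ∉ pℤ`, this value is not in `pvF`. Hence `(vE:vF) ≥ p`.
From the fundamental inequality it then follows that `(vE:vF) = p`"). Inside the algebraically
closed `(Ω, V)` of characteristic `p`: `K ≤ Ω` algebraically closed, `x` value-transcendental
over `K`, `F = K(x)^h` of rank one, `F ≤ E` Galois of degree `p`; then `(vE : vF) = p`. PROVED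
through Lemma 4.4, Artin–Schreier theory (`Literature/FieldTheory/ArtinSchreier/`) and the normal
form (`exists_normalForm_pow_sub_self`); over an algebraically closed `K` the alternative (4.6)
does not occur.
[cite: Kuhlmann2010, Prop. 4.5] -/
theorem relIndex_valueSubgroup_eq_of_isGaloisStep_charP [IsAlgClosed Ω] {p : ℕ} [Fact p.Prime]
    [CharP Ω p] {K : Subfield Ω} (hK : IsAlgClosed K) {x : Ω} (hx : IsValueTranscendentalOver V K x)
    (hr : IsRankOneValued V (henselizedAdjoin V K x)) {E : Subfield Ω}
    (hstep : IsGaloisStep p (henselizedAdjoin V K x) E) :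
    (valueSubgroup (henselizedAdjoin V K x) V).relIndex (valueSubgroup E V) = p := by
  classical
  have hp : p.Prime := Fact.out
  obtain ⟨hle, hdeg, hgal⟩ := hstep
  haveI := hgal
  haveI : FiniteDimensional (henselizedAdjoin V K x) (Subfield.extendScalars hle) :=
    Module.finite_of_finrank_pos (by rw [hdeg]; exact hp.pos)
  haveI : CharP (henselizedAdjoin V K x) p :=
    (algebraMap (henselizedAdjoin V K x) Ω).charP Subtype.val_injective p
  have hKF : K ≤ henselizedAdjoin V K x := le_henselizedAdjoin V K x
  have hxF : x ∈ henselizedAdjoin V K x := mem_henselizedAdjoin_self V K x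
  -- degrees
  have hrel : Subfield.relfinrank (henselizedAdjoin V K x) E = p := by
    rw [Subfield.relfinrank_eq_finrank_of_le hle, hdeg]
  have hpos : 0 < Subfield.relfinrank (henselizedAdjoin V K x) E := by
    rw [hrel]
    exact hp.pos
  ---------------------------------------------------------------- Artin–Schreier generator
  obtain ⟨ϑ, hϑE, ⟨a, ha⟩, hFϑ⟩ :=
    Literature.FieldTheory.ArtinSchreier.IntermediateField.exists_generator_pow_sub_self_mem
      (F := henselizedAdjoin V K x) (Subfield.extendScalars hle) hdeg
  have hϑE' : ϑ ∈ E := (Subfield.mem_extendScalars (h := hle)).mp hϑE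
  have haF : ϑ ^ p - ϑ ∈ henselizedAdjoin V K x := by
    rw [← ha]
    exact a.2
  ---------------------------------------------------------------- the normal form of `a = ℘(ϑ)`
  obtain ⟨c, hcsupp, d, hdF, heq⟩ := exists_normalForm_pow_sub_self (p := p) hK hx hr haF
  set ϑ' : Ω := ϑ - d with hϑ'def
  have hϑ'E : ϑ' ∈ E := sub_mem hϑE' (hle hdF)
  have hϑ' : ϑ' ^ p - ϑ' = c.sum fun i b => (b : Ω) * x ^ i := by
    rw [hϑ'def, sub_pow_char]
    linear_combination heq
  ---------------------------------------------------------------- `c ≠ 0` (else `ϑ ∈ F`)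
  have hc0 : c ≠ 0 := by
    intro hc0
    rw [hc0, Finsupp.sum_zero_index, sub_eq_zero] at hϑ'
    -- `ϑ'` lies in the prime field, so `ϑ = ϑ' + d ∈ F`
    obtain ⟨i, -, hi⟩ :=
      Literature.FieldTheory.ArtinSchreier.exists_natCast_eq_of_pow_eq_self (p := p) (E := Ω) hϑ'
    have hϑF : ϑ ∈ henselizedAdjoin V K x := by
      have : ϑ = ϑ' + d := by rw [hϑ'def]; ring
      rw [this, ← hi]
      exact add_mem (natCast_mem _ i) hdF
    -- then `F⟮ϑ⟯ = ⊥` has degree `1 ≠ p`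
    have hbot : IntermediateField.adjoin (henselizedAdjoin V K x) ({ϑ} : Set Ω) = ⊥ :=
      IntermediateField.adjoin_simple_eq_bot_iff.mpr ⟨⟨ϑ, hϑF⟩, rfl⟩
    have h1 : Module.finrank (henselizedAdjoin V K x) (Subfield.extendScalars hle) = 1 := by
      rw [← hFϑ, hbot, IntermediateField.finrank_bot]
    rw [hdeg] at h1
    exact hp.one_lt.ne' h1
  ---------------------------------------------------------------- the value of `ϑ'`
  obtain ⟨j, hj, hval, -⟩ := exists_valuation_finsupp_sum_eq hx hc0
  obtain ⟨hpj, hvj⟩ := hcsupp j hj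
  set mj : Ω := (c j : Ω) * x ^ j with hmjdef
  have hcj0 : ((c j : K) : Ω) ≠ 0 := fun h0 => (Finsupp.mem_support_iff.mp hj) (Subtype.ext h0)
  have hmj0 : mj ≠ 0 := mul_ne_zero hcj0 (zpow_ne_zero _ hx.ne_zero)
  have hmjF : mj ∈ henselizedAdjoin V K x := mul_mem (hKF (c j).2) (zpow_mem hxF j)
  have hvr : V.valuation (ϑ' ^ p - ϑ') = V.valuation mj := by rw [hϑ', hval]
  -- `v(ϑ') > 1`
  have hvϑ' : 1 < V.valuation ϑ' := by
    by_contra hle1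
    push Not at hle1
    have : V.valuation (ϑ' ^ p - ϑ') ≤ 1 := by
      refine le_trans (Valuation.map_sub _ _ _) (max_le ?_ hle1)
      rw [map_pow]
      exact pow_le_one₀ zero_le hle1
    rw [hvr] at this
    exact absurd hvj (not_lt.mpr this)
  -- `v(ϑ')^p = v(c_j x^j)`
  have hvϑ'p : V.valuation ϑ' ^ p = V.valuation mj := by
    rw [← hvr, ← map_pow]
    refine (Valuation.map_sub_eq_of_lt_left _ ?_).symm
    rw [map_pow]
    calc V.valuation ϑ' = V.valuation ϑ' ^ 1 := (pow_one _).symm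
      _ < V.valuation ϑ' ^ p := pow_lt_pow_right₀ hvϑ' hp.one_lt
  have hϑ'0 : ϑ' ≠ 0 := fun h0 => by
    rw [h0, map_zero] at hvϑ'
    exact not_lt_zero hvϑ'
  have hvϑ'0 : V.valuation ϑ' ≠ 0 := (_root_.map_ne_zero _).mpr hϑ'0
  ---------------------------------------------------------------- `v(ϑ') ∉ vF`
  have hnot : ∀ f ∈ henselizedAdjoin V K x, f ≠ 0 → V.valuation ϑ' ≠ V.valuation f := by
    intro f hf hf0 hvf
    -- `v(f) = v(c') v(x)^k` (Lemma 2.2, Lemma 2.5)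
    obtain ⟨b, hb, hfb⟩ := (Kuhlmann2010HenselizationImmediate_holds Ω V
      (IntermediateField.adjoin K ({x} : Set Ω)).toSubfield).1 f hf hf0
    have hb0 : b ≠ 0 := by
      rintro rfl
      rw [map_zero, map_eq_zero] at hfb
      exact hf0 hfb
    obtain ⟨c', hc', k, hbv⟩ := exists_valuation_eq_of_mem_adjoin hx hb hb0
    have hc'0 : c' ≠ 0 := by
      rintro rfl
      rw [map_zero, zero_mul, map_eq_zero] at hbv
      exact hb0 hbv
    -- `v(c_j x^j) = v(c'^p x^{kp})`, so `j = k p`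
    have h1 : V.valuation mj = V.valuation (c' ^ p * x ^ (k * p)) := by
      rw [← hvϑ'p, hvf, hfb, hbv, mul_pow, ← zpow_natCast (V.valuation x ^ k), ← zpow_mul, map_mul,
        map_pow, map_zpow₀]
    have hjk : j = k * p := hx.eq_of_valuation_mul_zpow_eq (c j).2 (pow_mem hc' p) hcj0 h1
    exact hpj ⟨k, by rw [hjk, mul_comm]⟩
  ---------------------------------------------------------------- `p ∣ (vE : vF) ≤ p`
  set γ : (ValuationSubring.ValueGroup V)ˣ := Units.mk0 (V.valuation ϑ') hvϑ'0 with hγdef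
  have hγE : γ ∈ valueSubgroup E V :=
    (mem_valueSubgroup_iff E V γ).mpr ⟨⟨ϑ', hϑ'E⟩, fun h0 => hϑ'0 (congrArg Subtype.val h0), rfl⟩
  have hγF : γ ∉ valueSubgroup (henselizedAdjoin V K x) V := by
    intro hmem
    obtain ⟨f, hf0, hγf⟩ := (mem_valueSubgroup_iff (henselizedAdjoin V K x) V γ).mp hmem
    exact hnot f f.2 (fun h0 => hf0 (Subtype.ext h0)) hγf
  have hγp : γ ^ p ∈ valueSubgroup (henselizedAdjoin V K x) V := by
    refine (mem_valueSubgroup_iff (henselizedAdjoin V K x) V _).mpr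
      ⟨⟨mj, hmjF⟩, fun h0 => hmj0 (congrArg Subtype.val h0), ?_⟩
    rw [Units.val_pow_eq_pow_val, hγdef, Units.val_mk0, hvϑ'p]
    rfl
  have hdvd : p ∣ (valueSubgroup (henselizedAdjoin V K x) V).relIndex (valueSubgroup E V) :=
    dvd_relIndex_of_pow_mem hp hγE hγF hγp
  obtain ⟨he, hf, hef⟩ := relIndex_mul_relfinrank_le_relfinrank V hle hpos
  rw [hrel] at hef
  exact le_antisymm (le_trans (Nat.le_mul_of_pos_right _ hf) hef) (Nat.le_of_dvd he hdvd)

end Prop45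

/-! ### Discharge of `Kuhlmann2010Prop45ValueIndex`; the italicized statement of §5 from Prop. 4.6 -/

/-- **DISCHARGE of `Kuhlmann2010Prop45ValueIndex`** (Kuhlmann 2010, Prop. 4.5, value index, over
an algebraically closed `K`): the left alternative `(vE:vF) = p` always holds
(`relIndex_valueSubgroup_eq_of_isGaloisStep_charP`). PROVED. [cite: Kuhlmann2010, Prop. 4.5] -/
theorem Kuhlmann2010Prop45ValueIndex_holds : Kuhlmann2010Prop45ValueIndex.{u} := by
  intro Ω _ _ V p _ _ hp K hK x hx hr E hstep
  haveI : Fact p.Prime := ⟨hp⟩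
  exact Or.inl (relIndex_valueSubgroup_eq_of_isGaloisStep_charP (V := V) hK hx hr hstep)

/-- **The italicized statement of §5 for `K(x)^h` from Prop. 4.6 alone** (everything else —
Hensel's Lemma, Lemma 2.4, Lemma 2.27, Lemma 4.4, Prop. 3.1 / the purely inseparable steps,
Prop. 4.5, and the finite Galois-level assembly — being PROVED).
[cite: Kuhlmann2010, Section 5, proof of Thm. 1.1 (p. 19)] -/
theorem Kuhlmann2010HenselizedRationalImmediateExt.of_prop46 (h46 : Kuhlmann2010Prop46ValueIndex.{u}) :
    Kuhlmann2010HenselizedRationalImmediateExt.{u} :=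
  Kuhlmann2010HenselizedRationalImmediateExt.of_props Kuhlmann2010Prop45ValueIndex_holds h46

end Literature.AlgebraicGeometry.Resolution
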